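import Summits.CriticalPhenomena.PercolationContinuityZ3.Theorems.PercNearOneGluingNoHeavyPcintBSMRFast2
import HarnessLib

/-!
# PCINT lane, PHASE 9 (reach-`m` pieces): a bit-mask certificate functional in the plane

Cell `prim-pcint`, seat `prim-pcint-1` (gen 17); memo `run/shared/lean/prim/pcint/T-FIBRE-ROUTE.md` §PHASE 9.
Kernel measurements showed the list-count functional of …PcintBSMRFast2 still costs ≈ 4 ms per pair (integer list
membership, `ℤ` order operations, large literals).  Here the shared-key count uses BIT MASKS built inside the kernel
from small bit-index lists (`BSMR.ccode2`: `((x+12)·25 + (y+12))·2 + axis`; `BSMR.tbits`, `BSMR.maskOf`): the count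
is the number of bits of `σ` (placed at `code + 312`) set in `mask σ' <<< (312 + off y)` (**`BSMR.Smask`**,
**`BSMR.S2_eq_Smask`**; `Nat.land`/`Nat.shiftLeft`/`Nat.testBit` are kernel-accelerated).  The functional
**`BSMR.certFastM`** is a double list sum in `ℕ` with an early exit for non-interacting pairs, endpoint codes for the
time-edge test and table lookups only for interacting pairs; **`BSMR.certLHSz_eq_certFastM`** bridges to `BSM.certLHSz`.
-/

noncomputable section

namespace Summit.CriticalPhenomena.PercolationContinuityZ3.Theorems.Pcint.BSMR

open Finset OSM BSM BSMX Literature.Probability.Percolation Literature.Probability.LatticeModels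

variable {np k : ℕ}

/-! ### Compact codes and masks -/

/-- The compact code of a (vertex, axis) pair with coordinates `≥ -12`: `((x+12)·25 + (y+12))·2 + axis`. -/
def ccode2 (v : ℤ × ℤ) (a : ℕ) : ℕ := (((v.1 + 12) * 25 + (v.2 + 12)) * 2 + a).toNat

/-- The compact code of a pair key (time keys get axis `0`; they never occur among transverse keys). -/
def ccodeK {k : ℕ} (q : LKey2 k) : ℕ :=
  match q.2 with
  | Sum.inl a => ccode2 q.1 a
  | Sum.inr _ => ccode2 q.1 0

/-- The bit-index list of the transverse keys of a piece started at `u` (mirror of `BSMX.tedges2`). -/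
def tbits : ℤ × ℤ → List (Fin 2 × Bool) → List ℕ
  | _, [] => []
  | u, q :: σ => ccode2 (if q.2 then u else u + sv2 q) q.1 :: tbits (u + sv2 q) σ

/-- The mask of a bit-index list. -/
def maskOf : List ℕ → ℕ
  | [] => 0
  | i :: l => Nat.lor (2 ^ i) (maskOf l)
/-- **The bits of the mask are the listed indices.** -/
theorem testBit_maskOf : ∀ (l : List ℕ) (j : ℕ), (maskOf l).testBit j = decide (j ∈ l)
  | [], j => by simp [maskOf]
  | i :: l, j => by
    rw [maskOf, show Nat.lor (2 ^ i) (maskOf l) = 2 ^ i ||| maskOf l from rfl, Nat.testBit_or, Nat.testBit_two_pow,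
      testBit_maskOf l j]
    by_cases h1 : i = j <;> by_cases h2 : j ∈ l <;> simp [h1, h2, eq_comm]

/-- **The codes of the keys are the bit list.** -/
theorem image_ccodeK_tedges2 (k : ℕ) : ∀ (u : ℤ × ℤ) (σ : List (Fin 2 × Bool)),
    (tedges2 k u σ).image ccodeK = (tbits u σ).toFinset
  | u, [] => by simp [tedges2, tbits]
  | u, q :: σ => by
    rw [tedges2, tbits, Finset.image_insert, image_ccodeK_tedges2 k _ σ, List.toFinset_cons]
    congr 1
    split_ifs <;> rfl

/-- Both coordinates of a step vector are at most one in absolute value. -/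
theorem abs_sv2_le (q : Fin 2 × Bool) : |(sv2 q).1| ≤ 1 ∧ |(sv2 q).2| ≤ 1 := by
  obtain ⟨i, b⟩ := q
  unfold sv2 tr2 sv
  fin_cases i <;> cases b <;> simp

/-- Keys of a piece are transverse, with both coordinates within `|σ|` of the start. -/
theorem mem_tedges2' (k : ℕ) : ∀ (u : ℤ × ℤ) (σ : List (Fin 2 × Bool)) (q : LKey2 k), q ∈ tedges2 k u σ →
    (∃ a, q.2 = Sum.inl a) ∧ |q.1.1 - u.1| ≤ σ.length ∧ |q.1.2 - u.2| ≤ σ.length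
  | u, [], q, h => by simp [tedges2] at h
  | u, p :: σ, q, h => by
    rw [tedges2, Finset.mem_insert] at h
    obtain ⟨hs1, hs2⟩ := abs_sv2_le p
    rw [abs_le] at hs1 hs2
    rcases h with rfl | h
    · refine ⟨?_, ?_, ?_⟩
      · split_ifs <;> exact ⟨_, rfl⟩
      · split_ifs <;> simp [abs_le] <;> constructor <;> linarith [hs1.1, hs1.2]
      · split_ifs <;> simp [abs_le] <;> constructor <;> linarith [hs2.1, hs2.2]
    · obtain ⟨ha, hb1, hb2⟩ := mem_tedges2' k _ σ q h
      refine ⟨ha, ?_, ?_⟩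
      · rw [abs_le] at hb1 ⊢
        simp only [Prod.fst_add, List.length_cons] at hb1 ⊢
        push_cast
        constructor <;> linarith [hb1.1, hb1.2, hs1.1, hs1.2]
      · rw [abs_le] at hb2 ⊢
        simp only [Prod.snd_add, List.length_cons] at hb2 ⊢
        push_cast
        constructor <;> linarith [hb2.1, hb2.2, hs2.1, hs2.2]

/-- The compact code as an integer, for coordinates `≥ -12`. -/
theorem ccode2_cast {v : ℤ × ℤ} (h1 : -12 ≤ v.1) (h2 : -12 ≤ v.2) (a : ℕ) :
    ((ccode2 v a : ℕ) : ℤ) = ((v.1 + 12) * 25 + (v.2 + 12)) * 2 + a := by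
  unfold ccode2
  rw [Int.toNat_of_nonneg (by omega)]

/-- **Injectivity of the compact code** on transverse keys with coordinates in `[-12, 12]`. -/
theorem ccodeK_inj {q q' : LKey2 k} (ha : ∃ a, q.2 = Sum.inl a) (ha' : ∃ a, q'.2 = Sum.inl a)
    (h1 : |q.1.1| ≤ 12) (h2 : |q.1.2| ≤ 12) (h1' : |q'.1.1| ≤ 12) (h2' : |q'.1.2| ≤ 12)
    (h : ccodeK q = ccodeK q') : q = q' := by
  obtain ⟨⟨x, y⟩, s⟩ := q
  obtain ⟨⟨x', y'⟩, s'⟩ := q'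
  obtain ⟨a, rfl⟩ := ha
  obtain ⟨a', rfl⟩ := ha'
  replace h1 : -12 ≤ x ∧ x ≤ 12 := abs_le.1 h1
  replace h2 : -12 ≤ y ∧ y ≤ 12 := abs_le.1 h2
  replace h1' : -12 ≤ x' ∧ x' ≤ 12 := abs_le.1 h1'
  replace h2' : -12 ≤ y' ∧ y' ≤ 12 := abs_le.1 h2'
  simp only [ccodeK] at h
  have hc : ((ccode2 (x, y) a : ℕ) : ℤ) = ccode2 (x', y') a' := by exact_mod_cast h
  rw [ccode2_cast (v := (x, y)) h1.1 h2.1, ccode2_cast (v := (x', y')) h1'.1 h2'.1] at hc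
  replace hc : ((x + 12) * 25 + (y + 12)) * 2 + ((a : ℕ) : ℤ) = ((x' + 12) * 25 + (y' + 12)) * 2 + ((a' : ℕ) : ℤ) := hc
  have ha2 := a.2; have ha2' := a'.2
  have e3 : (a : ℕ) = a' := by omega
  have e1 : x = x' := by omega
  have e2 : y = y' := by omega
  subst e1; subst e2
  have : a = a' := Fin.ext e3
  subst this
  rfl

/-- The code offset of a shift by `y`: `(y₁·25 + y₂)·2`. -/
def coff (y : ℤ × ℤ) : ℤ := (y.1 * 25 + y.2) * 2

/-- Shifting a transverse key (coordinates `≥ -12` before and after) shifts its code. -/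
theorem ccodeK_shift (y : ℤ × ℤ) {q : LKey2 k} (ha : ∃ a, q.2 = Sum.inl a) (h1 : -12 ≤ q.1.1) (h2 : -12 ≤ q.1.2)
    (h1' : -12 ≤ q.1.1 + y.1) (h2' : -12 ≤ q.1.2 + y.2) :
    ((ccodeK (shiftE2 k y q) : ℕ) : ℤ) = ccodeK q + coff y := by
  obtain ⟨⟨x₁, x₂⟩, s⟩ := q
  obtain ⟨a, rfl⟩ := ha
  simp only [ccodeK, shiftE2, Function.Embedding.coeFn_mk, coff]
  simp only at h1 h2 h1' h2'
  rw [ccode2_cast (by simpa using h1') (by simpa using h2'), ccode2_cast h1 h2]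
  simp only [Prod.fst_add, Prod.snd_add]
  ring

/-! ### The bit-mask shared-key count -/

/-- The shift amount of the second mask at offset `y`: `312 + coff y ≥ 0` for `|y| ≤ 6`. -/
def shOf (y : ℤ × ℤ) : ℕ := (312 + coff y).toNat

/-- **The bit-mask shared key count**: bits of the first piece (at `code + 312`, mask `MP`, list `bP`) set in the
shifted mask `MQs` of the second piece; early exit when the masks are disjoint. -/
def Smask (MP : ℕ) (bP : List ℕ) (MQs : ℕ) : ℕ :=
  let x := Nat.land MP MQs
  bif Nat.beq x 0 then 0 else (bP.filter fun i => x.testBit i).length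

/-- `Smask` without the early exit. -/
theorem Smask_eq (MP : ℕ) (bP : List ℕ) (MQs : ℕ) :
    Smask MP bP MQs = (bP.filter fun i => (Nat.land MP MQs).testBit i).length := by
  unfold Smask
  simp only
  cases h : Nat.beq (Nat.land MP MQs) 0
  · rfl
  · have h0 : Nat.land MP MQs = 0 := Nat.eq_of_beq_eq_true h
    rw [h0]
    simp

/-- **`S2 = Smask`** (pieces of length `≤ 6`, offsets `|y| ≤ 6`, bit list of the first piece duplicate-free). -/
theorem S2_eq_Smask (pc : Fin np → List (Fin 2 × Bool)) (k : ℕ) (y : Fin 2 → ℤ) (σ σ' : Fin np)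
    {bA bB : List ℕ} (hA : bA = tbits (0, 0) (pc σ)) (hB : bB = tbits (0, 0) (pc σ')) (hAn : bA.Nodup)
    (hσ : (pc σ).length ≤ 6) (hσ' : (pc σ').length ≤ 6) (hy0 : |y 0| ≤ 6) (hy1 : |y 1| ≤ 6) :
    S2 pc k y σ σ' = Smask (maskOf (bA.map (· + 312))) (bA.map (· + 312)) (Nat.shiftLeft (maskOf bB) (shOf (tr2 y))) := by
  set TA := tedges2 k (0, 0) (pc σ) with hTA
  set TB := tedges2 k (0, 0) (pc σ') with hTB
  set sh := shiftE2 k (tr2 y) with hsh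
  set s : ℕ := shOf (tr2 y) with hs
  have hy0' : |(tr2 y).1| ≤ 6 := hy0
  have hy1' : |(tr2 y).2| ≤ 6 := hy1
  rw [abs_le] at hy0' hy1'
  have hoff : 312 + coff (tr2 y) ≥ 0 := by unfold coff; omega
  have hs' : (s : ℤ) = 312 + coff (tr2 y) := by rw [hs, shOf, Int.toNat_of_nonneg hoff]
  have smA : ∀ a ∈ TA, (∃ i, a.2 = Sum.inl i) ∧ |a.1.1| ≤ 6 ∧ |a.1.2| ≤ 6 := fun a ha => by
    obtain ⟨h1, h2, h3⟩ := mem_tedges2' k _ _ a ha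
    simp only [sub_zero] at h2 h3
    have : ((pc σ).length : ℤ) ≤ 6 := by exact_mod_cast hσ
    exact ⟨h1, h2.trans this, h3.trans this⟩
  have smB : ∀ b ∈ TB, (∃ i, b.2 = Sum.inl i) ∧ |b.1.1| ≤ 6 ∧ |b.1.2| ≤ 6 := fun b hb => by
    obtain ⟨h1, h2, h3⟩ := mem_tedges2' k _ _ b hb
    simp only [sub_zero] at h2 h3
    have : ((pc σ').length : ℤ) ≤ 6 := by exact_mod_cast hσ'
    exact ⟨h1, h2.trans this, h3.trans this⟩
  have hbA : bA.toFinset = TA.image ccodeK := by rw [hA, hTA, image_ccodeK_tedges2]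
  have hbB : bB.toFinset = TB.image ccodeK := by rw [hB, hTB, image_ccodeK_tedges2]
  have hbit : ∀ e ∈ TA, ((Nat.land (maskOf (bA.map (· + 312))) (Nat.shiftLeft (maskOf bB) s)).testBit
      (ccodeK e + 312) = true ↔ e ∈ TB.map sh) := by
    intro e he
    obtain ⟨hei, he1, he2⟩ := smA e he
    rw [abs_le] at he1 he2
    rw [show Nat.land (maskOf (bA.map (· + 312))) (Nat.shiftLeft (maskOf bB) s) =
      (maskOf (bA.map (· + 312))) &&& ((maskOf bB) <<< s) from rfl, Nat.testBit_and, Nat.testBit_shiftLeft,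
      testBit_maskOf, testBit_maskOf]
    have hmemA : ccodeK e + 312 ∈ bA.map (· + 312) := by
      rw [List.mem_map]
      exact ⟨ccodeK e, by rw [← List.mem_toFinset, hbA, Finset.mem_image]; exact ⟨e, he, rfl⟩, rfl⟩
    have hcode : ((ccodeK e : ℕ) : ℤ) = ccodeK (shiftE2 k (-(tr2 y)) e) + coff (tr2 y) := by
      have := ccodeK_shift (k := k) (tr2 y) (q := shiftE2 k (-(tr2 y)) e) hei
        (by simp [shiftE2]; omega) (by simp [shiftE2]; omega) (by simp [shiftE2]; omega) (by simp [shiftE2]; omega)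
      have e2 : shiftE2 k (tr2 y) (shiftE2 k (-(tr2 y)) e) = e := by
        simp [shiftE2]
      rw [e2] at this
      exact this
    have hge : s ≤ ccodeK e + 312 := by
      have h0 : (0 : ℤ) ≤ (ccodeK (shiftE2 k (-(tr2 y)) e) : ℕ) := Nat.cast_nonneg _
      omega
    have hsub : ccodeK e + 312 - s = ccodeK (shiftE2 k (-(tr2 y)) e) := by omega
    simp only [hmemA, decide_true, Bool.true_and, ge_iff_le, hge, hsub, decide_eq_true_eq]
    rw [← List.mem_toFinset, hbB, Finset.mem_image, Finset.mem_map]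
    constructor
    · rintro ⟨b, hb, hbe⟩
      obtain ⟨hbi, hb1, hb2⟩ := smB b hb
      have heq := ccodeK_inj hbi (by obtain ⟨i, hi⟩ := hei; exact ⟨i, by simpa [shiftE2] using hi⟩)
        (hb1.trans (by norm_num)) (hb2.trans (by norm_num))
        (by simp only [shiftE2, Function.Embedding.coeFn_mk, Prod.fst_add, Prod.fst_neg, abs_le]; omega)
        (by simp only [shiftE2, Function.Embedding.coeFn_mk, Prod.snd_add, Prod.snd_neg, abs_le]; omega) hbe
      refine ⟨b, hb, ?_⟩
      rw [heq]; simp [hsh, shiftE2]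
    · rintro ⟨b, hb, rfl⟩
      refine ⟨b, hb, ?_⟩
      congr 1
      simp [hsh, shiftE2]
  unfold S2
  rw [← hTA, ← hTB, ← hsh, Smask_eq]
  have step1 : TA ∩ TB.map sh = TA.filter (fun e => e ∈ TB.map sh) := by
    ext e; simp [Finset.mem_inter, Finset.mem_filter]
  rw [step1]
  have hinjA : Set.InjOn ccodeK (TA : Set (LKey2 k)) := fun a ha a' ha' h =>
    ccodeK_inj (smA a ha).1 (smA a' ha').1 ((smA a ha).2.1.trans (by norm_num)) ((smA a ha).2.2.trans (by norm_num))
      ((smA a' ha').2.1.trans (by norm_num)) ((smA a' ha').2.2.trans (by norm_num)) h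
  set p : ℕ → Bool := fun i => (Nat.land (maskOf (bA.map (· + 312))) (Nat.shiftLeft (maskOf bB) s)).testBit i with hp
  rw [Finset.filter_congr (fun e he => (hbit e he).symm)]
  rw [← Finset.card_image_of_injOn (hinjA.mono (Finset.coe_subset.2 (Finset.filter_subset _ _)))]
  have step3 : (TA.filter fun e => p (ccodeK e + 312) = true).image ccodeK =
      (TA.image ccodeK).filter fun c => p (c + 312) = true := by
    ext c
    simp only [Finset.mem_image, Finset.mem_filter]
    constructor
    · rintro ⟨b, ⟨hb, hq⟩, rfl⟩; exact ⟨⟨b, hb, rfl⟩, hq⟩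
    · rintro ⟨⟨b, hb, rfl⟩, hq⟩; exact ⟨b, ⟨hb, hq⟩, rfl⟩
  rw [step3, ← hbA, ← List.toFinset_filter, List.toFinset_card_of_nodup (hAn.filter _), List.filter_map,
    List.length_map]
  rfl

/-! ### The bit-mask functional -/

/-- Pair-indexed table lookup at the sorted absolute values, with core `ℕ` operations only. -/
def look2q (tab : List (List ℕ)) (q : ℤ × ℤ) : ℕ :=
  let a := q.1.natAbs
  let b := q.2.natAbs
  if a ≤ b then (tab.getD a []).getD b 0 else (tab.getD b []).getD a 0

/-- `look2q ∘ tr2` is invariant under the dihedral generators. -/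
theorem look2q_gen2 (tab : List (List ℕ)) (g : Fin 3) (u : Fin 2 → ℤ) :
    look2q tab (tr2 (gen2 g u)) = look2q tab (tr2 u) := by
  rcases gen2_apply u with ⟨e0, e1, e2⟩
  have key : ∀ a b : ℕ, (if a ≤ b then (tab.getD a []).getD b 0 else (tab.getD b []).getD a 0) =
      (if b ≤ a then (tab.getD b []).getD a 0 else (tab.getD a []).getD b 0) := by
    intro a b
    rcases Nat.lt_trichotomy a b with h | h | h
    · simp [h.le, Nat.not_le.2 h]
    · subst h; rfl
    · simp [h.le, Nat.not_le.2 h]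
  unfold look2q tr2
  fin_cases g
  · simp only [Fin.zero_eta]; rw [e0]; simp only [Pi.neg_apply, Int.natAbs_neg]
  · simp only [Fin.mk_one]; rw [e1]; unfold pv
    simp only [Equiv.symm_swap, Equiv.swap_apply_left, Equiv.swap_apply_right]
    exact key _ _
  · simp only [Fin.reduceFinMk]; rw [e2]; simp [negC, Int.natAbs_neg]

/-- The endpoint code `(x+10)·64 + (y+10)` (coordinates `≥ -10`). -/
def pcode (v : ℤ × ℤ) : ℕ := ((v.1 + 10) * 64 + (v.2 + 10)).toNat

/-- The endpoint-code offset of `y`: `500 + y₁·64 + y₂ ≥ 0` for `|y| ≤ 6`. -/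
def eoff (y : ℤ × ℤ) : ℕ := (500 + (y.1 * 64 + y.2)).toNat

/-- **The endpoint test through codes**: `v = w + y ↔ pcode v + 500 = pcode w + eoff y` (small coordinates). -/
theorem pcode_eq_iff {v w y : ℤ × ℤ} (hv1 : |v.1| ≤ 3) (hv2 : |v.2| ≤ 3) (hw1 : |w.1| ≤ 3) (hw2 : |w.2| ≤ 3)
    (hy1 : |y.1| ≤ 6) (hy2 : |y.2| ≤ 6) : (Nat.beq (pcode v + 500) (pcode w + eoff y) = true) ↔ v = w + y := by
  obtain ⟨v1, v2⟩ := v; obtain ⟨w1, w2⟩ := w; obtain ⟨y1, y2⟩ := y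
  simp only at hv1 hv2 hw1 hw2 hy1 hy2
  rw [abs_le] at hv1 hv2 hw1 hw2 hy1 hy2
  rw [Nat.beq_eq, Prod.mk_add_mk, Prod.mk.injEq]
  unfold pcode eoff
  dsimp only
  zify
  rw [Int.toNat_of_nonneg (by omega), Int.toNat_of_nonneg (by omega), Int.toNat_of_nonneg (by omega)]
  omega

/-- One pair term of the bit-mask functional (records `(W, endpoint code, endpoint, bit list)` for the first piece,
`(W, endpoint code, endpoint, shifted mask)` for the second). -/
def termM (k A B E : ℕ) (V0t V1t : ℤ × ℤ → ℕ) (y : ℤ × ℤ) (eo : ℕ) (MP : ℕ) (bP : List ℕ)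
    (P : ℕ × ℕ × (ℤ × ℤ) × List ℕ) (Q : ℕ × ℕ × (ℤ × ℤ) × ℕ) : ℕ :=
  let s := Smask MP bP Q.2.2.2
  let e := Nat.beq (P.2.1 + 500) (Q.2.1 + eo)
  bif (Nat.beq s 0 && !e) then 0 else
    let n := s + (bif e then 1 else 0)
    let uo := y + (Q.2.2.1 - P.2.2.1)
    P.1 * Q.1 * ((A ^ n * B ^ (E - n) - B ^ E) * V0t uo + (k - 1) * ((A ^ s * B ^ (E - s) - B ^ E) * V1t uo))

/-- **The bit-mask integer certificate functional**: the second-piece masks are shifted once, the first-piece mask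
is built once per outer iteration, and the inner loop touches tables only for interacting pairs. -/
def certFastM (RS : List (ℕ × ℕ × (ℤ × ℤ) × List ℕ)) (k A B E : ℕ) (V0t V1t : ℤ × ℤ → ℕ) (y : ℤ × ℤ)
    (sh eo : ℕ) : ℕ :=
  let RQ := RS.map fun Q => (Q.1, Q.2.1, Q.2.2.1, Nat.shiftLeft (maskOf Q.2.2.2) sh)
  (RS.map fun P =>
    let bP := P.2.2.2.map (· + 312)
    let MP := maskOf bP
    (RQ.map fun Q => termM k A B E V0t V1t y eo MP bP P Q).sum).sum

/-- The pair term without the early exit. -/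
theorem termM_eq (k A B E : ℕ) (V0t V1t : ℤ × ℤ → ℕ) (y : ℤ × ℤ) (eo : ℕ) (MP : ℕ) (bP : List ℕ)
    (P : ℕ × ℕ × (ℤ × ℤ) × List ℕ) (Q : ℕ × ℕ × (ℤ × ℤ) × ℕ) :
    termM k A B E V0t V1t y eo MP bP P Q =
      P.1 * Q.1 * ((A ^ (Smask MP bP Q.2.2.2 + (bif Nat.beq (P.2.1 + 500) (Q.2.1 + eo) then 1 else 0)) *
        B ^ (E - (Smask MP bP Q.2.2.2 + (bif Nat.beq (P.2.1 + 500) (Q.2.1 + eo) then 1 else 0))) - B ^ E) *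
          V0t (y + (Q.2.2.1 - P.2.2.1)) +
        (k - 1) * ((A ^ Smask MP bP Q.2.2.2 * B ^ (E - Smask MP bP Q.2.2.2) - B ^ E) * V1t (y + (Q.2.2.1 - P.2.2.1)))) := by
  unfold termM
  simp only
  cases hs : Nat.beq (Smask MP bP Q.2.2.2) 0 <;> cases he : Nat.beq (P.2.1 + 500) (Q.2.1 + eo) <;>
    simp only [Bool.not_false, Bool.not_true, Bool.and_true, Bool.and_false, cond_true, cond_false]
  have h0 : Smask MP bP Q.2.2.2 = 0 := Nat.eq_of_beq_eq_true hs
  rw [h0]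
  simp

/-- **The bridge**: `BSM.certLHSz` (true shared-key count `BSM.S`, pair-indexed tables) equals the cast of
`BSMR.certFastM` on list-tabulated piece records, for pieces of length `≤ 6` with endpoints in `[-3,3]^2`, offsets
`|y| ≤ 6`, and `B ≤ A`. -/
theorem certLHSz_eq_certFastM (pc : Fin np → List (Fin 2 × Bool)) (RS : List (ℕ × ℕ × (ℤ × ℤ) × List ℕ))
    (hlen : RS.length = np) (W : Fin np → ℕ)
    (hRS : ∀ σ : Fin np, RS.getD σ (0, 0, (0, 0), []) =
      (W σ, pcode (tr2 (pend (pc σ))), tr2 (pend (pc σ)), tbits (0, 0) (pc σ)))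
    (hnd : ∀ σ, (tbits (0, 0) (pc σ)).Nodup) (hL : ∀ σ, (pc σ).length ≤ 6)
    (hpe : ∀ σ, |(tr2 (pend (pc σ))).1| ≤ 3 ∧ |(tr2 (pend (pc σ))).2| ≤ 3)
    (k A B E : ℕ) (hBA : B ≤ A) (hE : ∀ σ, (pc σ).length + 1 ≤ E) (V0t V1t : ℤ × ℤ → ℕ) {y : Fin 2 → ℤ}
    (hy0 : |y 0| ≤ 6) (hy1 : |y 1| ≤ 6) :
    certLHSz (fun σ => pend (pc σ)) (S pc k) W k A B E (fun u => V0t (tr2 u)) (fun u => V1t (tr2 u)) y =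
      ((certFastM RS k A B E V0t V1t (tr2 y) (shOf (tr2 y)) (eoff (tr2 y)) : ℕ) : ℤ) := by
  subst hlen
  have hget : ∀ σ : Fin RS.length, RS[(σ : ℕ)] =
      (W σ, pcode (tr2 (pend (pc σ))), tr2 (pend (pc σ)), tbits (0, 0) (pc σ)) := fun σ => by
    rw [← hRS σ, List.getD_eq_getElem _ _ σ.2]
  have hsum : ∀ (f : Fin RS.length → ℤ) (F : ℕ × ℕ × (ℤ × ℤ) × List ℕ → ℤ),
      (∀ i : Fin RS.length, f i = F RS[(i : ℕ)]) → ∑ i, f i = (RS.map F).sum := by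
    intro f F h
    have : List.ofFn f = RS.map F := by
      apply List.ext_getElem (by simp)
      intro i h1 h2
      rw [List.getElem_ofFn, List.getElem_map, h ⟨i, by simpa using h1⟩]
    rw [← List.sum_ofFn, this]
  have hyt0 : |(tr2 y).1| ≤ 6 := hy0
  have hyt1 : |(tr2 y).2| ≤ 6 := hy1
  unfold certLHSz certFastM
  dsimp only
  rw [Nat.cast_list_sum, List.map_map]
  refine hsum _ _ fun σ => ?_
  rw [Function.comp_apply, Nat.cast_list_sum, List.map_map, List.map_map]
  refine hsum _ _ fun σ' => ?_
  rw [Function.comp_apply, Function.comp_apply, hget σ, hget σ', termM_eq]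
  dsimp only
  have hS : Smask (maskOf ((tbits (0, 0) (pc σ)).map (· + 312))) ((tbits (0, 0) (pc σ)).map (· + 312))
      (Nat.shiftLeft (maskOf (tbits (0, 0) (pc σ'))) (shOf (tr2 y))) = S pc k y σ σ' := by
    rw [S_eq_S2, S2_eq_Smask pc k y σ σ' rfl rfl (hnd σ) (hL σ) (hL σ') hy0 hy1]
  rw [hS]
  have he : (bif Nat.beq (pcode (tr2 (pend (pc σ))) + 500) (pcode (tr2 (pend (pc σ'))) + eoff (tr2 y)) then 1 else 0) =
      (if pend (pc σ) = pend (pc σ') + y then 1 else 0) := by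
    have hiff := pcode_eq_iff (hpe σ).1 (hpe σ).2 (hpe σ').1 (hpe σ').2 hyt0 hyt1
    by_cases h : pend (pc σ) = pend (pc σ') + y
    · have hb : Nat.beq (pcode (tr2 (pend (pc σ))) + 500) (pcode (tr2 (pend (pc σ'))) + eoff (tr2 y)) = true :=
        hiff.2 (by rw [← tr2_add, h])
      rw [hb, if_pos h]; rfl
    · have hb : Nat.beq (pcode (tr2 (pend (pc σ))) + 500) (pcode (tr2 (pend (pc σ'))) + eoff (tr2 y)) = false := by
        cases hb : Nat.beq (pcode (tr2 (pend (pc σ))) + 500) (pcode (tr2 (pend (pc σ'))) + eoff (tr2 y))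
        · rfl
        · exact absurd (tr2_injective (by rw [tr2_add]; exact hiff.1 hb)) h
      rw [hb, if_neg h]; rfl
  rw [he]
  have hs : S pc k y σ σ' ≤ E := (S_le_length pc k y σ σ').trans (by have := hE σ'; omega)
  have hn : S pc k y σ σ' + (if pend (pc σ) = pend (pc σ') + y then 1 else 0) ≤ E := by
    have := S_le_length pc k y σ σ'; have := hE σ'; split_ifs <;> omega
  have h1 : B ^ E ≤ A ^ (S pc k y σ σ' + (if pend (pc σ) = pend (pc σ') + y then 1 else 0)) *
      B ^ (E - (S pc k y σ σ' + (if pend (pc σ) = pend (pc σ') + y then 1 else 0))) := by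
    set n := S pc k y σ σ' + (if pend (pc σ) = pend (pc σ') + y then 1 else 0)
    calc B ^ E = B ^ n * B ^ (E - n) := by rw [← pow_add, Nat.add_sub_cancel' hn]
      _ ≤ A ^ n * B ^ (E - n) := Nat.mul_le_mul_right _ (Nat.pow_le_pow_left hBA n)
  have h2 : B ^ E ≤ A ^ S pc k y σ σ' * B ^ (E - S pc k y σ σ') := by
    calc B ^ E = B ^ S pc k y σ σ' * B ^ (E - S pc k y σ σ') := by rw [← pow_add, Nat.add_sub_cancel' hs]
      _ ≤ A ^ S pc k y σ σ' * B ^ (E - S pc k y σ σ') := Nat.mul_le_mul_right _ (Nat.pow_le_pow_left hBA _)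
  have huo : tr2 y + (tr2 (pend (pc σ')) - tr2 (pend (pc σ))) = tr2 (y + (pend (pc σ') - pend (pc σ))) := by
    rw [tr2_add, tr2_sub]
  rw [huo]
  push_cast [Nat.cast_sub h1, Nat.cast_sub h2]
  ring

end Summit.CriticalPhenomena.PercolationContinuityZ3.Theorems.Pcint.BSMR

end
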